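import Mathlib
import Summits.Ventures.PercRepro2.Defs
import Summits.Ventures.PercRepro2.Independence
import Summits.Ventures.PercRepro2.Harris
import Summits.Ventures.PercRepro2.ThreeEventSafe
import Summits.Ventures.PercRepro2.ThreeEventCross
import Summits.Ventures.PercRepro2.ThreeEventCertificate
import Summits.Ventures.PercRepro2.ThreeEventCertificateSwap
import Summits.Ventures.PercRepro2.ThreeEventCertificateInduction
import Summits.Ventures.PercRepro2.ThreeEventAD
import Summits.Ventures.PercRepro2.ThreeEventCertificateAD

/-!
# The three-event lemma modulo (∃-SYM-AD) (blind cell PercRepro2, p4 g33; proofs/P4-G33-CROSS.md §4f)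

The specialisation of the certificate induction with Ahlswede–Daykin terms
(`defect_nonneg_of_sym_certificates_ad`) to the class of admissible quadruples: if every admissible
quadruple has, for every admissible weight vector, an unpinned edge with a symmetrised pointwise
certificate made of two admissible instances and two Ahlswede–Daykin terms, then the three-event
lemma `Cov(M, B ∩ H) ≤ Cov(G, H)` holds for all admissible quadruples. No definition, no instance,
no notation.
-/

namespace Summit.Ventures.PercRepro2

namespace ThreeEvent

section Induction

variable {E : Type*} [Fintype E] [DecidableEq E] {R : Type*} [CommRing R] [LinearOrder R]
  [IsStrictOrderedRing R]

/-- **The three-event lemma modulo (∃-SYM-AD).** -/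
theorem cov_inter_le_cov_of_sym_certificates_ad
    (hcert : ∀ (G H M B : Set (Config E)),
      (IsUpperSet G ∧ IsUpperSet H ∧ IsUpperSet M ∧ IsLowerSet B ∧ M ⊆ G ∧ G ∩ B ⊆ M) →
      ∀ p : E → R, IsProbVec p → (unpinned p).Nonempty →
        ∃ e ∈ unpinned p, ∃ (G₁ H₁ M₁ B₁ G₂ H₂ M₂ B₂ X₁ Y₁ C₁ D₁ X₂ Y₂ C₂ D₂ : Set (Config E))
          (l₁ l₂ m₁ m₂ : R),
          (IsUpperSet G₁ ∧ IsUpperSet H₁ ∧ IsUpperSet M₁ ∧ IsLowerSet B₁ ∧ M₁ ⊆ G₁ ∧ G₁ ∩ B₁ ⊆ M₁)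
          ∧ (IsUpperSet G₂ ∧ IsUpperSet H₂ ∧ IsUpperSet M₂ ∧ IsLowerSet B₂ ∧ M₂ ⊆ G₂ ∧ G₂ ∩ B₂ ⊆ M₂)
          ∧ 0 ≤ l₁ ∧ 0 ≤ l₂ ∧ 0 ≤ m₁ ∧ 0 ≤ m₂ ∧
          (∀ a ∈ X₁, ∀ b ∈ Y₁, a ⊓ b ∈ C₁ ∧ a ⊔ b ∈ D₁) ∧
          (∀ a ∈ X₂, ∀ b ∈ Y₂, a ⊓ b ∈ C₂ ∧ a ⊔ b ∈ D₂) ∧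
          ∀ ω ω' : Config E, ω e = true → ω' e = true →
            l₁ * (pairWt G₁ H₁ M₁ B₁ ω ω' + pairWt G₁ H₁ M₁ B₁ ω' ω)
              + l₂ * (pairWt G₂ H₂ M₂ B₂ ω ω' + pairWt G₂ H₂ M₂ B₂ ω' ω)
              + m₁ * ((D₁.indicator (1 : Config E → R) ω * C₁.indicator 1 ω'
                        - X₁.indicator (1 : Config E → R) ω * Y₁.indicator 1 ω')
                      + (D₁.indicator (1 : Config E → R) ω' * C₁.indicator 1 ω
                        - X₁.indicator (1 : Config E → R) ω' * Y₁.indicator 1 ω))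
              + m₂ * ((D₂.indicator (1 : Config E → R) ω * C₂.indicator 1 ω'
                        - X₂.indicator (1 : Config E → R) ω * Y₂.indicator 1 ω')
                      + (D₂.indicator (1 : Config E → R) ω' * C₂.indicator 1 ω
                        - X₂.indicator (1 : Config E → R) ω' * Y₂.indicator 1 ω))
              ≤ (pairWt G H M B (Function.update ω e false) ω'
                  + pairWt G H M B ω (Function.update ω' e false))
                + (pairWt G H M B (Function.update ω' e false) ω
                  + pairWt G H M B ω' (Function.update ω e false)))
    {G H M B : Set (Config E)} (hG : IsUpperSet G) (hH : IsUpperSet H) (hM : IsUpperSet M)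
    (hB : IsLowerSet B) (hMG : M ⊆ G) (hGB : G ∩ B ⊆ M) {p : E → R} (hp : IsProbVec p) :
    prob p (M ∩ (B ∩ H)) - prob p M * prob p (B ∩ H) ≤ prob p (G ∩ H) - prob p G * prob p H :=
  sub_nonneg.1 (defect_nonneg_of_sym_certificates_ad
    (fun G H M B => IsUpperSet G ∧ IsUpperSet H ∧ IsUpperSet M ∧ IsLowerSet B ∧ M ⊆ G ∧ G ∩ B ⊆ M)
    hcert G H M B ⟨hG, hH, hM, hB, hMG, hGB⟩ p hp)

end Induction

end ThreeEvent

end Summit.Ventures.PercRepro2
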